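import Literature.Algebra.Homology.ExtDualityPairing
import Mathlib.Algebra.Homology.DerivedCategory.Ext.ExactSequences
import HarnessLib

/-!
# The formal shell of Poitou–Tate `Ker γ ⊆ Im β` (Milne ADT I Thm. 4.10, proof): injectivity of the
# duality map on the quotient turns "pairs trivially" into "comes from the subobject"

Topic `Algebra/Homology`; namespace `Literature.Algebra.Homology.ExtDuality`.  Theorems only, for
Mathlib's `Abelian.Ext` in any abelian category with `HasExt`; no definition, no named fact, no
instance, no `sorry`.  Sequel of `ExtDualityPairing`.

Milne's proof of I Thm. 4.10 (p. 58): apply `Ext_G(M^D, –)` to `0 → E_S → J_S → C_S → 0`; the image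
of `Extʳ(M^D, E_S) → Extʳ(M^D, J_S)` is the kernel of `Extʳ(M^D, J_S) → Extʳ(M^D, C_S)`, and
`Extʳ(M^D, C_S) → H^{2−r}(G_S, M^D)^*` (the map `αʳ` of Thm. 1.8) is injective; hence a class of
`Extʳ(M^D, J_S) = Pʳ_S(K, M)` that pairs trivially with `H^{2−r}(G_S, M^D)` comes from
`Extʳ(M^D, E_S) = Hʳ(G_S, M)`.  Here, for a short exact `S : 0 → X₁ → X₂ → X₃ → 0`, an object `N`,
`inv : Ext²(P, X₃) →+ Q` and bidegree `s + r = 2`: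

* `pairing_comp_mk₀_g` : `⟨t ∘ g, y⟩ = inv (y ∘ t ∘ g)`-bookkeeping;
* **`exists_comp_mk₀_f_eq_of_pairing_eq_zero`**: if `αʳ(X₃)` (for `N`) is injective and
  `t ∈ Extʳ(N, X₂)` satisfies `inv (y ∘ (t ∘ g)) = 0` for all `y ∈ Extˢ(P, N)`, then `t = s ∘ f` for some
  `s ∈ Extʳ(N, X₁)`;
* `comp_mk₀_g_eq_zero_iff`, the converse direction `pairing_comp_mk₀_f_g` (classes from `X₁` pair
  trivially: `(s ∘ f) ∘ g = 0`).

Written for Route A of the Poitou–Tate programme of crux `stmt-BirchSwinnertonDyer-19295` (cell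
`bsd-schneider-ideate`, seat door-c4 gen 15): with `S = (0 → F̄ˣ → J̄ → C̄ → 0)` (door-c5 g16),
`N = M^D`, `r = 1`, and `adjointMap_one_injective` (`DiscreteRepTateDuality`) this is the `Ext`-side of
`Ker γ¹ ⊆ Im β¹`; what remains is the identification of the three terms and of the pairing (A3/A6).
HONEST FRAMING: homological algebra only.

## References
* J. S. Milne, *Arithmetic Duality Theorems* (2nd ed. 2006), I §4, Theorem 4.10 and its proof (p. 58),
  Lemma 4.12, Lemma 4.13. [MilneADT2006]
* D. Harari, *Galois Cohomology and Class Field Theory*, Universitext (2020), §17.3 (Poitou–Tate,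
  proof of Theorem 17.13). [Harari2020]
-/

noncomputable section

universe w' w v u

namespace Literature.Algebra.Homology

namespace ExtDuality

open CategoryTheory CategoryTheory.Abelian

variable {𝒞 : Type u} [Category.{v} 𝒞] [Abelian 𝒞] [HasExt.{w} 𝒞]
  {P : 𝒞} {Q : Type w'} [AddCommGroup Q] {S : ShortComplex 𝒞} (hS : S.ShortExact)
  (inv : Ext P S.X₃ 2 →+ Q) (N : 𝒞)

/-- `⟨t ∘ g, y⟩ = inv (y ∘ (t ∘ g))` (unfolding). [cite: MilneADT2006, I Theorem 4.10 (proof)] -/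
theorem pairing_comp_mk₀_g {r s : ℕ} (h : s + r = 2) (t : Ext N S.X₂ r) (y : Ext P N s) :
    pairing inv N h (t.comp (Ext.mk₀ S.g) (add_zero r)) y =
      inv (y.comp (t.comp (Ext.mk₀ S.g) (add_zero r)) h) := rfl

include hS in
/-- Exactness at `Extʳ(N, X₂)`: `t ∘ g = 0` iff `t = s ∘ f` for some `s ∈ Extʳ(N, X₁)`.
[cite: MilneADT2006, I Theorem 4.10 (proof)] -/
theorem comp_mk₀_g_eq_zero_iff {r : ℕ} (t : Ext N S.X₂ r) :
    t.comp (Ext.mk₀ S.g) (add_zero r) = 0 ↔ ∃ s : Ext N S.X₁ r, s.comp (Ext.mk₀ S.f) (add_zero r) = t := by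
  constructor
  · intro ht
    exact Ext.covariant_sequence_exact₂ (hS := hS) (X := N) t ht
  · rintro ⟨s, rfl⟩
    rw [Ext.comp_assoc_of_third_deg_zero, Ext.mk₀_comp_mk₀, S.zero, Ext.mk₀_zero, Ext.comp_zero]

include hS in
/-- **`Ker ⊆ Im` through the duality map**: if `αʳ(X₃)` is injective (for the object `N`) and
`t ∈ Extʳ(N, X₂)` pairs trivially — `inv (y ∘ (t ∘ g)) = 0` for every `y ∈ Extˢ(P, N)` — then
`t = s ∘ f` for some `s ∈ Extʳ(N, X₁)`.  (Milne I 4.10: a class of `P¹ = Ext¹(M^D, J̄)` orthogonal to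
`H¹(K, M^D)` comes from `H¹(K, M) = Ext¹(M^D, K̄ˣ)`.) [cite: MilneADT2006, I Theorem 4.10 (proof)][cite: Harari2020, §17.3] -/
theorem exists_comp_mk₀_f_eq_of_pairing_eq_zero {r s : ℕ} (h : s + r = 2)
    (hα : AdjointInjective inv N h) (t : Ext N S.X₂ r)
    (ht : ∀ y : Ext P N s, inv (y.comp (t.comp (Ext.mk₀ S.g) (add_zero r)) h) = 0) :
    ∃ s : Ext N S.X₁ r, s.comp (Ext.mk₀ S.f) (add_zero r) = t := by
  rw [← comp_mk₀_g_eq_zero_iff hS N t]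
  apply (injective_iff_map_eq_zero _).1 hα
  ext y
  rw [AddMonoidHom.zero_apply]
  exact ht y

/-- Conversely classes coming from `X₁` pair trivially: `inv (y ∘ ((s ∘ f) ∘ g)) = 0`.
[cite: MilneADT2006, I Theorem 4.10 (proof)] -/
theorem pairing_comp_mk₀_f_g {r s : ℕ} (h : s + r = 2) (s₁ : Ext N S.X₁ r) (y : Ext P N s) :
    inv (y.comp ((s₁.comp (Ext.mk₀ S.f) (add_zero r)).comp (Ext.mk₀ S.g) (add_zero r)) h) = 0 := by
  rw [Ext.comp_assoc_of_third_deg_zero, Ext.mk₀_comp_mk₀, S.zero, Ext.mk₀_zero, Ext.comp_zero,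
    Ext.comp_zero, map_zero]

end ExtDuality

end Literature.Algebra.Homology
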